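import Summits.HodgeConjecture.HodgeConjecture.Theorems.F0P3cStCharTSUpEval                -- ★ p851558 (this seat) (γ) «UP-EVAL★» `up_eq_sum_of_transversal`; brings ★ UpDom (UP-DEF currency)
import Summits.HodgeConjecture.HodgeConjecture.Theorems.F0P3cStCharTSMovingSection         -- ★ p851575 (this seat) (c) «MOVING-SECTION★»; brings ★ FibreRealise, ★ EllOpen, ★ DGFieldReg
import Summits.HodgeConjecture.HodgeConjecture.Theorems.F0P3cStCharTSNormOnePersist        -- ★ p851547 (this seat) (α) «NORM-ONE-PERSIST★»; brings ★ RootRecip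
import Summits.HodgeConjecture.HodgeConjecture.Theorems.F0P3cStCharTSNormOneRootsNear      -- ★ p851589 (this seat) (b′) «NORM-ONE-ROOTS-NEAR★»; brings ★ RootCalculus, ★ RootCount
import Summits.HodgeConjecture.HodgeConjecture.Theorems.F0P3cStCharTSMovingRoot            -- ★ (LH4-p03 g7) (β) «MOVING-ROOT★» `exists_continuousAt_root`; brings ★ RootPersist
import Summits.HodgeConjecture.HodgeConjecture.Theorems.F0P3cStCharTSCharField             -- ★ `qsForm_map_cmConjRingHom_transpose`, `det_qsForm_ne_zero`
import Literature.NumberTheory.Rogawski1990.FinExplicitTransferFactorEventuallyConst       -- ★ `finTau_eventually_eq`; brings ★ `finKappaAt_eventually_eq`, ★ `isUnit_eval_finCharpolyTwo_of_isLocalGRegular`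
import Literature.NumberTheory.Rogawski1990.LocalNormFibreSurjectiveNonsplit              -- ★ `apply_mul_map_apply_eq_one_of_local_one` (the `U(1)`-slot is norm-one, read at `w`)
import HarnessLib

/-!
# F0 · P3c · line LH6 «StCharTS» — S13b «UPR-LC★» HEAD: under the (UP-DEF) field equation, `χ ↦ χ^G = up χ` is LOCALLY CONSTANT at every regular point of `U(Φ₃)(L⁺_v)`
# (the local-constancy half of ★ `EllipticData.UpRegularity`, Rogawski 1990 §12.5 Lemma 12.5.1 p. 183) — road (I) «moving norm-one roots», assembled from ★ bricks

Cell `pub/hodgecm-mathlib`, crux H413 = `stmt-HodgeConjecture-24833` (lane `--supports … --as helper`), route HCCMUnconditional; seat F0P3-p02 (g20); datum road of the (S-𝔇)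
organ `stub_EllipticPackage` (`Cruxes/H413/Lines/F0_P3c_StCharTSPaydown.lean`), slice S13b «UPR-LC» (handed over by LH4-p01 (g5) 12:37Z; PLAN `F0/P3/F0P3-p02/g20/S13b-PLAN.v1.F0P3p02g20.md`).
THEOREMS ONLY (no definition ∕ instance ∕ notation ∕ named fact ∕ `sorry`); ★-only imports.
HONEST LABEL: HC_CM is proved only modulo the 7 printed citations (2 remaining named inputs: hLiu418 = `stmt-HodgeConjecture-24832`, h413 = `stmt-HodgeConjecture-24833`)
until rung 0 closes; this file closes no organ and is count-neutral: (UPR) `UpRegularity` stays ONE named input [p. 183] unless its local-integrability half is also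
derived; this file derives the local-constancy half from (UP-DEF) + «D_G-lc» + «D_H-lc» + «α-lc» (all dischargeable at the junction: ★ DG-LC `DG_eventually_eq_of_mem_regG`,
★ `DGtwo_fst_eventually_eq`, clause 3 of ★ `exists_charSt`).

THE MATHEMATICS (non-split `v`, `w` the place over `v`, `R = ∏_{w′∣v} L_{w′} ≃ L_w`, `σ = c ⊗ 1`).  Fix a regular `x`.  The norm-one roots `a ∈ A` of `(charpoly x)_w` are simple;
each persists as a continuously moving root `u_a(y)` isolated in a window (★ MOVING-ROOT), stays norm-one (★ NORM-ONE-PERSIST), lifts to `R` and carries a section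
`s_a(y) ∈ H_v` continuous at `x`, `G`-regular, matching `y`, with `U(1)`-slot `u_a(y)` (★ MOVING-SECTION); no other norm-one roots appear near `x` (★ NORM-ONE-ROOTS-NEAR), so
`{s_a(y)}_{a ∈ A}` is a transversal of the norm fibre of `y` ((F2)∕(F3) ★ `LocalNormFibreNonsplit`) and (★ UP-EVAL) `up α y = D_G(y)⁻¹ Σ_{a∈A} τ(s_a y) D_H(s_a y) κ(s_a y, y) α(s_a y)`;
each factor is locally constant along `y ↦ (s_a y, y)` (★ `finTau_eventually_eq`, ★ `finKappaAt_eventually_eq`, «D_H-lc», «α-lc»), and `D_G` is («D_G-lc»).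

* `up_eventually_eq_of_upDef` — HEAD, for any stable class function `α` on `regH` locally constant at `G`-regular points;
* `upRegularity_lc_of_upDef` — the (UPR) local-constancy clause verbatim for `α = packetCharH ρ`, `ρ ∈ Π²(H)`.

## References
* [Rogawski1990] J. D. Rogawski, *Automorphic Representations of Unitary Groups in Three Variables*, Ann. of Math. Stud. 123 (1990): §12.5 Lemma 12.5.1 p. 183 (`D_G(γ)α^G(γ)` as a
  finite sum of values of `α` on the matched classes), §4.9 p. 55 (`τ`, `κ`, `D_{G∕H}`), §5.4 p. 78 (the matched stable classes and their `U(1)`-slots), §3.1 p. 19.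
* [LanglandsShelstad1987] R. P. Langlands, D. Shelstad, *On the definition of transfer factors*, Math. Ann. 278 (1987), Lemma 4.1.A — background (local constancy of transfer factors).
-/

set_option autoImplicit false
-- the mandated namespace has the single-problem summit's repeated segment (`HodgeConjecture.HodgeConjecture`)
set_option linter.dupNamespace false

noncomputable section

open Polynomial Filter Topology
open NumberField IsDedekindDomain
open scoped Matrix MatrixGroups Classical
open Literature.NumberTheory.Rogawski1990 Literature.NumberTheory.Automorphic Literature.NumberTheory.Automorphic.UnitaryGroup
open Literature.NumberTheory.GaloisRepresentations

namespace Summit.HodgeConjecture.HodgeConjecture.Cruxes.H413.F0P3cStCharTSUprLc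

variable (L : Type) [Field L] [NumberField L] [IsCMField L] (v : HeightOneSpectrum (𝓞 ↥(maximalRealSubfield L)))

/-- **S13b «UPR-LC» HEAD — `up α` IS LOCALLY CONSTANT AT REGULAR POINTS under (UP-DEF).**  On an `EllipticData` over `(U(Φ₃)(L⁺_v), H_v)` at a non-split `v` whose `up` satisfies
the (UP-DEF) field equation (★ `upDom_of_upDef`'s `hUp`, verbatim), with `regG = G^{reg}`, `stConjH = ∼_st`, `G`-regular `⊆ regH`, `D_H` stable and locally constant on `G`-regular
classes and `D_G` locally constant on `regG`: for every stable class function `α` on `regH` that is locally constant at `G`-regular points,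
`∀ x ∈ regG, ∀ᶠ y in 𝓝 x, up α y = up α x`. [cite: Rogawski1990, §12.5 Lemma 12.5.1 p. 183; §4.9 p. 55; §5.4 p. 78] -/
theorem up_eventually_eq_of_upDef (μ : HeckeCharacter L)
    (hns : ∀ w : UnitaryGroup.PlacesOver L v, IsCMField.complexConj L • w.1 = w.1)
    [MeasurableSpace (Gqs L v)] [∀ γ : Gqs L v, MeasurableSpace (Gqs L v ⧸ Subgroup.centralizer ({γ} : Set (Gqs L v)))]
    [MeasurableSpace (Gqs L v ⧸ Subgroup.center (Gqs L v))]
    [MeasurableSpace ((UnitaryGroup.cmDatum L 2 (Matrix.of fun i j : Fin 2 => if i.val + j.val + 1 = 2 then (1 : L) else 0)).Local v ×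
      (UnitaryGroup.cmDatum L 1 (Matrix.of fun i j : Fin 1 => if i.val + j.val + 1 = 1 then (1 : L) else 0)).Local v)]
    (𝔇 : Ch12Sec5.EllipticData (Gqs L v)
      ((UnitaryGroup.cmDatum L 2 (Matrix.of fun i j : Fin 2 => if i.val + j.val + 1 = 2 then (1 : L) else 0)).Local v ×
        (UnitaryGroup.cmDatum L 1 (Matrix.of fun i j : Fin 1 => if i.val + j.val + 1 = 1 then (1 : L) else 0)).Local v))
    (hreg : ∀ γ : Gqs L v, γ ∈ 𝔇.regG ↔ IsRegularElt (γ.val : GL (Fin 3) (UnitaryGroup.LocalRing L v)))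
    (hStH : ∀ a b, 𝔇.stConjH a b ↔ IsLocalStablyConjH L v a b)
    (hRegH : ∀ a, IsLocalGRegular L v a → a ∈ 𝔇.regH)
    (hDHst : ∀ a b, IsLocalGRegular L v a → IsLocalStablyConjH L v a b → 𝔇.DH b = 𝔇.DH a)
    (hDHlc : ∀ a, IsLocalGRegular L v a → ∀ᶠ a' in 𝓝 a, 𝔇.DH a' = 𝔇.DH a)
    (hDGlc : ∀ x ∈ 𝔇.regG, ∀ᶠ y in 𝓝 x, 𝔇.DG y = 𝔇.DG x)
    (hUp : ∀ (α : ((UnitaryGroup.cmDatum L 2 (Matrix.of fun i j : Fin 2 => if i.val + j.val + 1 = 2 then (1 : L) else 0)).Local v ×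
        (UnitaryGroup.cmDatum L 1 (Matrix.of fun i j : Fin 1 => if i.val + j.val + 1 = 1 then (1 : L) else 0)).Local v) → ℂ) (x : Gqs L v),
      𝔇.up α x =
        if IsRegularElt (x.val : GL (Fin 3) (UnitaryGroup.LocalRing L v)) then
          ((𝔇.DG x : ℂ))⁻¹ *
            ∑ᶠ q : Quot (IsLocalStablyConjH L v),
              (if IsLocalGRegular L v q.out ∧ IsLocalNormPair L (qsForm L) v q.out x then
                finTau L v q.out μ * (𝔇.DH q.out : ℂ) * ((finKappaAt L v (qsForm L) q.out x : ℤ) : ℂ) * α q.out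
              else 0)
        else 0)
    (α : ((UnitaryGroup.cmDatum L 2 (Matrix.of fun i j : Fin 2 => if i.val + j.val + 1 = 2 then (1 : L) else 0)).Local v ×
        (UnitaryGroup.cmDatum L 1 (Matrix.of fun i j : Fin 1 => if i.val + j.val + 1 = 1 then (1 : L) else 0)).Local v) → ℂ)
    (hα : Ch12Sec5.IsStableClassFunOn 𝔇.stConjH 𝔇.regH α)
    (hαlc : ∀ a, IsLocalGRegular L v a → ∀ᶠ a' in 𝓝 a, α a' = α a) :
    ∀ x ∈ 𝔇.regG, ∀ᶠ y in 𝓝 x, 𝔇.up α y = 𝔇.up α x := by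
  intro x hx
  haveI : Algebra.IsQuadraticExtension ↥(maximalRealSubfield L) L := IsCMField.isQuadraticExtension L
  obtain ⟨w⟩ := UnitaryGroup.PlacesOver.nonempty L v
  have hw := hns w
  haveI : ProperSpace (w.1.adicCompletion L) := properSpace_adicCompletion L w.1
  have hxreg : IsRegularElt (x.val : GL (Fin 3) (UnitaryGroup.LocalRing L v)) := (hreg x).1 hx
  -- notation
  set φ := Pi.evalRingHom (fun w' : UnitaryGroup.PlacesOver L v => w'.1.adicCompletion L) w with hφ
  set σ := conjLocal L (IsCMField.complexConj L) v with hσ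
  set σw := galAdicCompletionMap (L := L) (IsCMField.complexConj L) hw with hσw
  set P : Gqs L v → (w.1.adicCompletion L)[X] := fun y => ((y.val : GL (Fin 3) (UnitaryGroup.LocalRing L v)).val.charpoly).map φ with hP
  have hφinj : Function.Injective φ := F0P3cStCharTSEllOpen.evalPlace_injective L v w hw
  have hP0 : ∀ y, P y ≠ 0 := fun y => (F0P3cStCharTSNormOneRootsNear.monic_map_charpoly L v w y).ne_zero
  -- (1) the old norm-one roots `A`
  set A : Finset (w.1.adicCompletion L) := (P x).roots.toFinset.filter (fun a => σw a * a = 1) with hAdef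
  have hAroot : ∀ a ∈ A, (P x).IsRoot a := fun a ha =>
    (mem_roots (hP0 x)).1 (Multiset.mem_toFinset.1 (Finset.mem_filter.1 ha).1)
  have hA1 : ∀ a ∈ A, σw a * a = 1 := fun a ha => (Finset.mem_filter.1 ha).2
  have hA : ∀ a, (P x).IsRoot a → σw a * a = 1 → a ∈ A := fun a hr h1 =>
    Finset.mem_filter.2 ⟨Multiset.mem_toFinset.2 ((mem_roots (hP0 x)).2 hr), h1⟩
  -- (2) they are simple
  have hsep : (P x).Separable := Polynomial.Separable.map hxreg
  have hsimple : ∀ a ∈ A, (derivative (P x)).eval a ≠ 0 := fun a ha =>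
    F0P3cStCharTSRootCount.eval_derivative_ne_zero_of_separable hsep a ((mem_roots (hP0 x)).2 (hAroot a ha))
  -- (3) ★ MOVING-ROOT for each `a ∈ A`
  have hdeg : ∀ᶠ y in 𝓝 x, (P y).natDegree < 4 := Filter.Eventually.of_forall fun y => by
    show (((y.val : GL (Fin 3) (UnitaryGroup.LocalRing L v)).val.charpoly).map _).natDegree < 4
    rw [F0P3cStCharTSNormOneRootsNear.natDegree_map_charpoly]; norm_num
  have hcoeff : ∀ i, ContinuousAt (fun y => (P y).coeff i) x := fun i => by
    have h := (F0P3cStCharTSEllOpen.continuous_evalPlace_charpoly_coeff L v w i).continuousAt (x := x)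
    simpa only [hP, coeff_map] using h
  have hmr : ∀ a : w.1.adicCompletion L, ∃ (δ : ℝ) (u : Gqs L v → w.1.adicCompletion L), a ∈ A →
      0 < δ ∧ u x = a ∧ ContinuousAt u x ∧
        ∀ᶠ y in 𝓝 x, (P y).IsRoot (u y) ∧ ‖u y - a‖ < δ ∧ ∀ r, (P y).IsRoot r → ‖r - a‖ < δ → r = u y := fun a => by
    by_cases ha : a ∈ A
    · obtain ⟨δ, u, hδ, hu0, hu, hwin⟩ := F0P3cStCharTSMovingRoot.exists_continuousAt_root P hdeg hcoeff (hAroot a ha) (hsimple a ha)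
      exact ⟨δ, u, fun _ => ⟨hδ, hu0, hu, hwin⟩⟩
    · exact ⟨1, fun _ => 0, fun h => absurd h ha⟩
  choose δ u hδu using hmr
  have hδ : ∀ a ∈ A, 0 < δ a := fun a ha => (hδu a ha).1
  have hu0 : ∀ a ∈ A, u a x = a := fun a ha => (hδu a ha).2.1
  have huc : ∀ a ∈ A, ContinuousAt (u a) x := fun a ha => (hδu a ha).2.2.1
  have hwin : ∀ a ∈ A, ∀ᶠ y in 𝓝 x, (P y).IsRoot (u a y) ∧ ‖u a y - a‖ < δ a ∧ ∀ r, (P y).IsRoot r → ‖r - a‖ < δ a → r = u a y :=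
    fun a ha => (hδu a ha).2.2.2
  -- (4) ★ NORM-ONE-PERSIST
  have hn1 : ∀ a ∈ A, ∀ᶠ y in 𝓝 x, σw (u a y) * u a y = 1 := fun a ha =>
    F0P3cStCharTSNormOnePersist.eventually_conj_mul_self_eq_one L v w hw (hδ a ha) (hu0 a ha) (huc a ha) (hA1 a ha) (hwin a ha)
  -- (5) lift to `R`
  obtain ⟨ψ, hψc, hψ⟩ := F0P3cStCharTSMovingSection.exists_continuous_rightInverse_evalPlace L v w hw
  have hUc : ∀ a ∈ A, ContinuousAt (fun y => ψ (u a y)) x := fun a ha => hψc.continuousAt.comp (huc a ha)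
  have hevR : ∀ a ∈ A, ∀ᶠ y in 𝓝 x, IsRegularElt (y.val : GL (Fin 3) (UnitaryGroup.LocalRing L v)) ∧
      ((y.val : GL (Fin 3) (UnitaryGroup.LocalRing L v)).val.charpoly).IsRoot (ψ (u a y)) ∧ σ (ψ (u a y)) * ψ (u a y) = 1 := fun a ha => by
    filter_upwards [F0P3cStCharTSMovingSection.eventually_isRegularElt L v hxreg, hwin a ha, hn1 a ha] with y hyreg hyw hy1
    refine ⟨hyreg, ?_, ?_⟩
    · refine F0P3cStCharTSMovingSection.isRoot_of_isRoot_map_evalPlace L v w hw _ _ ?_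
      rw [hψ]; exact hyw.1
    · refine F0P3cStCharTSMovingSection.conj_mul_eq_one_of_evalPlace L v w hw _ ?_
      rw [hψ]; exact hy1
  -- (6) ★ MOVING-SECTION for each `a ∈ A`
  have hms : ∀ a : w.1.adicCompletion L, ∃ s : Gqs L v →
      (UnitaryGroup.cmDatum L 2 (Matrix.of fun i j : Fin 2 => if i.val + j.val + 1 = 2 then (1 : L) else 0)).Local v ×
        (UnitaryGroup.cmDatum L 1 (Matrix.of fun i j : Fin 1 => if i.val + j.val + 1 = 1 then (1 : L) else 0)).Local v,
      a ∈ A → ContinuousAt s x ∧ ∀ᶠ y in 𝓝 x, IsLocalGRegular L v (s y) ∧ IsLocalNormPair L (qsForm L) v (s y) y ∧ finGammaTwo L v (s y) = ψ (u a y) := fun a => by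
    by_cases ha : a ∈ A
    · obtain ⟨s, hsc, hsev⟩ := F0P3cStCharTSMovingSection.exists_continuousAt_section L v w hw x (fun y => ψ (u a y)) (hUc a ha) (hevR a ha)
      exact ⟨s, fun _ => ⟨hsc, hsev⟩⟩
    · exact ⟨fun _ => 1, fun h => absurd h ha⟩
  choose s hs using hms
  have hsc : ∀ a ∈ A, ContinuousAt (s a) x := fun a ha => (hs a ha).1
  have hsev : ∀ a ∈ A, ∀ᶠ y in 𝓝 x, IsLocalGRegular L v (s a y) ∧ IsLocalNormPair L (qsForm L) v (s a y) y ∧ finGammaTwo L v (s a y) = ψ (u a y) :=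
    fun a ha => (hs a ha).2
  have hsx : ∀ a ∈ A, IsLocalGRegular L v (s a x) ∧ IsLocalNormPair L (qsForm L) v (s a x) x ∧ finGammaTwo L v (s a x) = ψ (u a x) :=
    fun a ha => (hsev a ha).self_of_nhds
  -- (7) ★ NORM-ONE-ROOTS-NEAR: no other norm-one roots near `x`
  have hexh : ∀ᶠ y in 𝓝 x, ∀ r, (P y).IsRoot r → σw r * r = 1 → ∃ a ∈ A, r = u a y :=
    F0P3cStCharTSNormOneRootsNear.eventually_forall_norm_one_root_eq L v w hw x A hA u δ hδ
      (fun a ha => (hwin a ha).mono fun y hy => hy.2.2)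
  -- (8) the moved roots stay distinct
  obtain ⟨ε, hε, hsepA⟩ := F0P3cStCharTSRootCount.exists_pos_separating A
  have hnear : ∀ᶠ y in 𝓝 x, ∀ a ∈ A, ‖u a y - a‖ < ε := by
    rw [Filter.eventually_all_finset]
    intro a ha
    exact F0P3cStCharTSMovingRoot.eventually_norm_sub_lt_of_continuousAt (hu0 a ha) (huc a ha) hε
  have hdist : ∀ᶠ y in 𝓝 x, ∀ a ∈ A, ∀ a' ∈ A, u a y = u a' y → a = a' := by
    filter_upwards [hnear] with y hy a ha a' ha' he
    by_contra hne
    have h2 := hsepA a ha a' ha' hne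
    have h3 : ‖a - a'‖ ≤ ‖u a y - a‖ + ‖u a' y - a'‖ := by
      calc ‖a - a'‖ = ‖(u a' y - a') - (u a y - a)‖ := by rw [he]; congr 1; abel
        _ ≤ ‖u a' y - a'‖ + ‖u a y - a‖ := norm_sub_le _ _
        _ = ‖u a y - a‖ + ‖u a' y - a'‖ := add_comm _ _
    linarith [hy a ha, hy a' ha']
  -- (9) termwise local constancy along `y ↦ (s_a y, y)`
  set Φ : Gqs L v → ((UnitaryGroup.cmDatum L 2 (Matrix.of fun i j : Fin 2 => if i.val + j.val + 1 = 2 then (1 : L) else 0)).Local v ×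
        (UnitaryGroup.cmDatum L 1 (Matrix.of fun i j : Fin 1 => if i.val + j.val + 1 = 1 then (1 : L) else 0)).Local v) → ℂ :=
    fun y b => finTau L v b μ * (𝔇.DH b : ℂ) * ((finKappaAt L v (qsForm L) b y : ℤ) : ℂ) * α b with hΦ
  have hterm : ∀ᶠ y in 𝓝 x, ∀ a ∈ A, IsLocalNormPair L (qsForm L) v (s a y) y → Φ y (s a y) = Φ x (s a x) := by
    rw [Filter.eventually_all_finset]
    intro a ha
    obtain ⟨hregx, hnpx, -⟩ := hsx a ha
    have hux : IsUnit ((finCharpolyTwo L v (s a x)).eval (finGammaTwo L v (s a x))) := isUnit_eval_finCharpolyTwo_of_isLocalGRegular L v (s a x) hregx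
    have hτ := ((hsc a ha).tendsto).eventually (finTau_eventually_eq L v μ hux)
    have hD := ((hsc a ha).tendsto).eventually (hDHlc (s a x) hregx)
    have hαe := ((hsc a ha).tendsto).eventually (hαlc (s a x) hregx)
    have hpair : Tendsto (fun y => (s a y, y)) (𝓝 x) (𝓝 (s a x, x)) := ((hsc a ha).prodMk continuousAt_id).tendsto
    have hκ := hpair.eventually (finKappaAt_eventually_eq L v (qsForm L) (F0P3cStCharTSCharField.qsForm_map_cmConjRingHom_transpose L)
      (F0P3cStCharTSCharField.det_qsForm_ne_zero L) hnpx hux)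
    filter_upwards [hτ, hD, hαe, hκ] with y hyτ hyD hyα hyκ hnp
    simp only [hΦ]
    rw [hyτ, hyD, hyα, hyκ hnp]
  -- (10) the transversal formula at every good `y`, and at `x`
  have hsevA : ∀ᶠ y in 𝓝 x, ∀ a ∈ A, IsLocalGRegular L v (s a y) ∧ IsLocalNormPair L (qsForm L) v (s a y) y ∧ finGammaTwo L v (s a y) = ψ (u a y) :=
    (Filter.eventually_all_finset A).2 hsev
  have hkey : ∀ᶠ y in 𝓝 x, 𝔇.up α y = ((𝔇.DG y : ℂ))⁻¹ * ∑ a ∈ A, Φ y (s a y) := by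
    filter_upwards [hsevA, hexh, hdist, F0P3cStCharTSMovingSection.eventually_isRegularElt L v hxreg] with y hyA hyexh hydist hyreg
    -- injectivity of `a ↦ s a y` on `A` via the `U(1)`-slots
    have hslot : ∀ a ∈ A, ∀ a' ∈ A, finGammaTwo L v (s a y) = finGammaTwo L v (s a' y) → a = a' := by
      intro a ha a' ha' he
      rw [(hyA a ha).2.2, (hyA a' ha').2.2] at he
      have he' : u a y = u a' y := by rw [← hψ (u a y), ← hψ (u a' y)]; exact congrArg φ he
      exact hydist a ha a' ha' he'
    have hinj : Set.InjOn (fun a => s a y) ↑A := fun a ha a' ha' he => hslot a ha a' ha' (by simp only at he; rw [he])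
    have hS : ∀ t ∈ A.image (fun a => s a y), IsLocalGRegular L v t ∧ IsLocalNormPair L (qsForm L) v t y := by
      intro t ht
      obtain ⟨a, ha, rfl⟩ := Finset.mem_image.1 ht
      exact ⟨(hyA a ha).1, (hyA a ha).2.1⟩
    have hpair : ∀ t ∈ A.image (fun a => s a y), ∀ t' ∈ A.image (fun a => s a y), t ≠ t' → ¬ IsLocalStablyConjH L v t t' := by
      intro t ht t' ht' hne hst
      obtain ⟨a, ha, rfl⟩ := Finset.mem_image.1 ht
      obtain ⟨a', ha', rfl⟩ := Finset.mem_image.1 ht'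
      exact hne (by rw [hslot a ha a' ha' (hst.finGammaTwo_eq L v)])
    have hexhS : ∀ b, IsLocalGRegular L v b → IsLocalNormPair L (qsForm L) v b y → ∃ t ∈ A.image (fun a => s a y), IsLocalStablyConjH L v b t := by
      intro b hb hnp
      -- the `U(1)`-slot of `b` read at `w` is a norm-one root of `(charpoly y)_w`
      have hroot : (P y).IsRoot (φ (finGammaTwo L v b)) :=
        (F0P3cStCharTSEllOpen.isRoot_map_iff_of_injective φ hφinj _ _).2 (hnp.isRoot_finGammaTwo L (qsForm L) v)
      have hone : σw (φ (finGammaTwo L v b)) * φ (finGammaTwo L v b) = 1 := by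
        rw [mul_comm]
        exact apply_mul_map_apply_eq_one_of_local_one L v w hw b.2
      obtain ⟨a, ha, hra⟩ := hyexh _ hroot hone
      have hfg : finGammaTwo L v b = finGammaTwo L v (s a y) := by
        rw [(hyA a ha).2.2]
        apply hφinj
        rw [hψ]; exact hra
      exact ⟨s a y, Finset.mem_image_of_mem _ ha, isLocalStablyConjH_of_isLocalNormPair_of_finGammaTwo_eq L (qsForm L) v hb hnp (hyA a ha).2.1 hfg⟩
    rw [F0P3cStCharTSUpEval.up_eq_sum_of_transversal L v μ 𝔇 hStH hRegH hDHst hUp α hα y hyreg (A.image (fun a => s a y)) hS hpair hexhS,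
      Finset.sum_image hinj]
  have hkeyx := hkey.self_of_nhds
  -- (11) assemble
  filter_upwards [hkey, hterm, hsevA, hDGlc x hx] with y hy hyt hyA hyDG
  rw [hy, hkeyx, hyDG]
  congr 1
  exact Finset.sum_congr rfl fun a ha => hyt a ha (hyA a ha).2.1

/-- **(UPR) local-constancy clause, verbatim**: under the hypotheses of `up_eventually_eq_of_upDef` and the (M1H)-type facts «`χ_ρ` is a stable class function on `regH`» and «`χ_ρ` is
locally constant at `G`-regular points» for `ρ ∈ Π²(H)`: `∀ ρ ∈ 𝔇.sqPacketsH, ∀ x ∈ 𝔇.regG, ∀ᶠ y in 𝓝 x, 𝔇.up (𝔇.packetCharH ρ) y = 𝔇.up (𝔇.packetCharH ρ) x` — the second conjunct of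
★ `EllipticData.UpRegularity`. [cite: Rogawski1990, §12.5 Lemma 12.5.1 p. 183] -/
theorem upRegularity_lc_of_upDef (μ : HeckeCharacter L)
    (hns : ∀ w : UnitaryGroup.PlacesOver L v, IsCMField.complexConj L • w.1 = w.1)
    [MeasurableSpace (Gqs L v)] [∀ γ : Gqs L v, MeasurableSpace (Gqs L v ⧸ Subgroup.centralizer ({γ} : Set (Gqs L v)))]
    [MeasurableSpace (Gqs L v ⧸ Subgroup.center (Gqs L v))]
    [MeasurableSpace ((UnitaryGroup.cmDatum L 2 (Matrix.of fun i j : Fin 2 => if i.val + j.val + 1 = 2 then (1 : L) else 0)).Local v ×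
      (UnitaryGroup.cmDatum L 1 (Matrix.of fun i j : Fin 1 => if i.val + j.val + 1 = 1 then (1 : L) else 0)).Local v)]
    (𝔇 : Ch12Sec5.EllipticData (Gqs L v)
      ((UnitaryGroup.cmDatum L 2 (Matrix.of fun i j : Fin 2 => if i.val + j.val + 1 = 2 then (1 : L) else 0)).Local v ×
        (UnitaryGroup.cmDatum L 1 (Matrix.of fun i j : Fin 1 => if i.val + j.val + 1 = 1 then (1 : L) else 0)).Local v))
    (hreg : ∀ γ : Gqs L v, γ ∈ 𝔇.regG ↔ IsRegularElt (γ.val : GL (Fin 3) (UnitaryGroup.LocalRing L v)))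
    (hStH : ∀ a b, 𝔇.stConjH a b ↔ IsLocalStablyConjH L v a b)
    (hRegH : ∀ a, IsLocalGRegular L v a → a ∈ 𝔇.regH)
    (hDHst : ∀ a b, IsLocalGRegular L v a → IsLocalStablyConjH L v a b → 𝔇.DH b = 𝔇.DH a)
    (hDHlc : ∀ a, IsLocalGRegular L v a → ∀ᶠ a' in 𝓝 a, 𝔇.DH a' = 𝔇.DH a)
    (hDGlc : ∀ x ∈ 𝔇.regG, ∀ᶠ y in 𝓝 x, 𝔇.DG y = 𝔇.DG x)
    (hUp : ∀ (α : ((UnitaryGroup.cmDatum L 2 (Matrix.of fun i j : Fin 2 => if i.val + j.val + 1 = 2 then (1 : L) else 0)).Local v ×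
        (UnitaryGroup.cmDatum L 1 (Matrix.of fun i j : Fin 1 => if i.val + j.val + 1 = 1 then (1 : L) else 0)).Local v) → ℂ) (x : Gqs L v),
      𝔇.up α x =
        if IsRegularElt (x.val : GL (Fin 3) (UnitaryGroup.LocalRing L v)) then
          ((𝔇.DG x : ℂ))⁻¹ *
            ∑ᶠ q : Quot (IsLocalStablyConjH L v),
              (if IsLocalGRegular L v q.out ∧ IsLocalNormPair L (qsForm L) v q.out x then
                finTau L v q.out μ * (𝔇.DH q.out : ℂ) * ((finKappaAt L v (qsForm L) q.out x : ℤ) : ℂ) * α q.out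
              else 0)
        else 0)
    (hM1 : ∀ ρ ∈ 𝔇.sqPacketsH, Ch12Sec5.IsStableClassFunOn 𝔇.stConjH 𝔇.regH (𝔇.packetCharH ρ))
    (hM1lc : ∀ ρ ∈ 𝔇.sqPacketsH, ∀ a, IsLocalGRegular L v a → ∀ᶠ a' in 𝓝 a, 𝔇.packetCharH ρ a' = 𝔇.packetCharH ρ a) :
    ∀ ρ ∈ 𝔇.sqPacketsH, ∀ x ∈ 𝔇.regG, ∀ᶠ y in 𝓝 x, 𝔇.up (𝔇.packetCharH ρ) y = 𝔇.up (𝔇.packetCharH ρ) x :=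
  fun ρ hρ => up_eventually_eq_of_upDef L v μ hns 𝔇 hreg hStH hRegH hDHst hDHlc hDGlc hUp (𝔇.packetCharH ρ) (hM1 ρ hρ) (hM1lc ρ hρ)

end Summit.HodgeConjecture.HodgeConjecture.Cruxes.H413.F0P3cStCharTSUprLc

end
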